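import Literature.Probability.LatticeModels.CriticalTwoPointBounds
import Literature.Probability.LatticeModels.OnsagerToeplitz
import Literature.Probability.LatticeModels.OnsagerSzego
import Literature.Probability.LatticeModels.OnsagerToeplitzDecay
import Literature.Probability.LatticeModels.IsingTranslationInvariance
import HarnessLib

/-!
# The planar spontaneous magnetisation at the self-dual point: `m*(β_c(2)) = 0`, its reductions and its discharge

Topic `Probability/LatticeModels`, namespace `Literature.Probability.LatticeModels`. Theorem-only
sibling of `PlanarIsing.lean` (no definition, no named fact) around the named fact
`Literature.Probability.LatticeModels.spontaneousMagnetization_two_criticalBetaTwo`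
(`m*(β_c(2)) = 0` for the nearest-neighbour Ising model on `ℤ²`, `β_c(2) = ½ log (1 + √2)` the
self-dual point; C. N. Yang, Phys. Rev. **85** (1952) 808; rigorous: Benettin–Gallavotti–
Jona-Lasinio–Stella, Comm. Math. Phys. **30** (1973) 45). It records, sorry-free, what this fact
rests on in the tree, along the two printed routes:

* **The exact solution** (Yang 1952; BGJS 1973, §3; `OnsagerYang.lean`, `OnsagerYangProofs.lean`,
  `OnsagerToeplitz.lean`): `m*(β_c(2)) = 0` is the `β = β_c(2)` case of the Onsager–Yang formula
  `onsager_yang` (`spontaneousMagnetization_two_criticalBetaTwo_of_onsager_yang`), hence follows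
  from the three exact-solution inputs left open by `OnsagerToeplitz.onsager_yang_of_toeplitz`
  (`spontaneousMagnetization_two_criticalBetaTwo_of_toeplitz`): the row correlations of the
  cylinder as Toeplitz determinants (Montroll–Potts–Ward 1963 / Schultz–Mattis–Lieb 1964), the
  strong Szegő limit theorem, and Wu's 1966 decay above `T_c`. All three are now THEOREMS of the
  tree: `OnsagerToeplitzProofs.torusRowPair_tendsto_toeplitzDet_holds` (transfer matrix, Kaufman's
  rotation, the Perron–Fock vacuum, Wick's theorem), `Literature.Analysis.Toeplitz.strongSzego_geometric`
  (`StrongSzegoGeometric.lean`: the strong Szegő limit theorem for continuous `V` with geometrically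
  decaying Fourier coefficients, which covers Onsager's `V_β = log φ_β` above `β_c(2)`; assembled in
  `OnsagerSzego.onsager_yang_of_wu`), and `OnsagerToeplitzDecay.toeplitzDet_onsagerSymbol_exp_decay_holds`
  (Wu 1966). Hence the Onsager–Yang formula holds outright (`onsager_yang_of_wu` fed with
  `toeplitzDet_onsagerSymbol_exp_decay_holds`; cf. `HighDimTrivialityWickProofs.onsager_yang_of_tree`)
  and with it the target: **`spontaneousMagnetization_two_criticalBetaTwo_holds`**, the DISCHARGE of
  the named fact, closes this file.
* **The random-current criterion of Aizenman–Duminil-Copin–Sidoravicius** (Comm. Math. Phys.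
  **334** (2015) 719, arXiv:1311.1937v3, "ADS15"; Thm. 1.2 with §3.2, and the remark closing §1.4:
  "while (1.18) is not satisfied in two dimensions, Theorem 1.2 is of relevance also for this
  case, since the condition (1.12) [`M̃_LRO = 0`] can be established for the nearest neighbor
  model on the square … lattice through the Fortuin–Kasteleyn random cluster representation (see
  [Gri06] Theorem 6.17)"). The §3.2 mechanism of ADS15 is a theorem of the tree at every `β ≥ 0`
  and in every dimension (`MagnetizationContinuity.spontaneousMagnetization_eq_zero_of_lroTildeSq_eq_zero`
  fed with `plusPair_eq_freePair_of_lroTildeSq_holds`, `plusExpect_spinAt_mul_le_plusPair_holds`,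
  `plusExpect_spinAt_eq_spontaneousMagnetization_holds`); here it is assembled into the
  hypothesis-free `spontaneousMagnetization_eq_zero_of_lroTildeSq` and, with the elementary
  Cesàro step `lroTildeSq_eq_zero_of_twoPointFree_tendsto_zero` (ADS15 §1.3, eq. (1.10):
  `inf_x ⟨σ₀σ_x⟩⁰ ≤ M̃_LRO² ≤ M_LRO²`) and its converse (Lebowitz–Martin-Löf: `m* = 0 ⇒ ⟨·⟩^∅ =
  ⟨·⟩⁺`, `PlusFreeComparison`; clustering of the plus state, `OnsagerYang`), into the dichotomy
  `spontaneousMagnetization_eq_zero_iff_twoPointFree_tendsto_zero`: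
  **`m*(β) = 0 ⟺ ⟨σ₀σ_x⟩^∅_{β,0} → 0` as `x → ∞`**, for `d ≥ 1`, `β ≥ 0`. At `d = 2`, `β = β_c(2)`
  this reduces `spontaneousMagnetization_two_criticalBetaTwo` to the single statement that the
  FREE two-point function of the square lattice at the self-dual point tends to zero
  (`spontaneousMagnetization_two_criticalBetaTwo_iff_twoPointFree_tendsto_zero`) — Kaufman–Onsager
  1949 (`M̃_LRO(β_c) = 0`, ADS15 §1.5) or, without the exact solution, Zhang's argument
  `θ⁰(p_sd(2), 2) = 0` for the random-cluster model (Grimmett, *The Random-Cluster Model* (2006),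
  Thm. 6.17 (a)), neither of which is in the tree (no infinite-volume random-cluster measures).
  By Kramers–Wannier self-duality (`KramersWannierDuality.kw_free_plus_holds` at `β* = β`,
  `dualBeta_criticalBetaTwo`) the same condition reads: the plus-state DISORDER correlator at
  `β_c(2)` tends to zero (`twoPointFree_criticalBetaTwo_eq_plusExpect_kwDisorder`).

One discharge (`spontaneousMagnetization_two_criticalBetaTwo_holds`); no statement of the tree is
modified or restated; no definition and no new named fact is introduced.

## Mathlib / tree anchors

`Filter.mem_cofinite`, `Iio_mem_nhds`, `Finset.card_le_card_of_injOn`, `Finset.sum_boole`,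
`le_of_forall_pos_le_add`, `Filter.Tendsto.congr`; tree: `freeCorr_shift`
(`IsingTranslationInvariance`), `twoPointFree_nonneg`, `twoPointFree_le_one`, `spinPair_eq_spinProduct`
(`SharpnessProofs`), `le_lroTildeSq`, `lroTildeSq_le`, `freeBlockAverage_nonneg`,
`freeCorr_eq_plusCorr_of_spontaneousMagnetization_eq_zero` (`PlusFreeComparison`),
`twoPointPlus_tendsto_spontaneousMagnetization_sq_holds` (`OnsagerYang`), `onsager_yang_of_toeplitz`
(`OnsagerToeplitz`), `onsager_yang_of_wu` (`OnsagerSzego`), `toeplitzDet_onsagerSymbol_exp_decay_holds`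
(`OnsagerToeplitzDecay`), `twoPointFree_eq_twoPointPlus_of_spontaneousMagnetization_eq_zero`
(`PlusFreeComparison`), `kw_free_plus_holds`, `kw_plus_free_holds`, `dualBeta_criticalBetaTwo`
(`KramersWannierDuality`).

## References

* C. N. Yang, Phys. Rev. 85 (1952) 808–816.
* G. Benettin, G. Gallavotti, G. Jona-Lasinio, A. L. Stella, Comm. Math. Phys. 30 (1973) 45–54, §3.
* M. Aizenman, H. Duminil-Copin, V. Sidoravicius, Comm. Math. Phys. 334 (2015) 719–742
  (arXiv:1311.1937v3), §1.3 eqs. (1.9)–(1.10), Thm. 1.2, §1.4 (last paragraph), §3.2.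
* G. Grimmett, *The Random-Cluster Model*, Springer 2006, Thm. 6.17 (a) (Zhang's argument).
* S. Friedli, Y. Velenik, *Statistical Mechanics of Lattice Systems*, CUP 2017, Thm. 3.17,
  Exercises 3.15–3.16.
-/

noncomputable section

open MeasureTheory Filter Topology Finset Literature.Probability.LatticeModels

namespace Literature.Probability.LatticeModels

/-! ### Any dimension: `M̃_LRO(β) = 0 ⇒ m*(β) = 0`, and the dichotomy at fixed `β` -/

section AnyDimension

variable {d : ℕ}

/-- **Translation invariance of the free pair correlation**, `⟨σ_xσ_y⟩^∅_{β,0} = ⟨σ₀σ_{y−x}⟩^∅_{β,0}`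
for `β ≥ 0` (Friedli–Velenik 2017, Exercise 3.16 with Thm. 3.17 (2); the tree's `freeCorr_shift`
applied to `A = {0, y − x}`, `v = x`). [cite: FriedliVelenik2017, Exercise 3.16 with Thm. 3.17] -/
theorem freePair_eq_twoPointFree_sub {β : ℝ} (hβ : 0 ≤ β) (x y : Site d) :
    freePair d β x y = twoPointFree d β (y - x) := by
  classical
  rcases eq_or_ne x y with rfl | hxy
  · rw [freePair_self, sub_self, twoPointFree_zero]
  have h0 : (0 : Site d) ≠ y - x := fun h => hxy (sub_eq_zero.1 h.symm).symm
  have hmap : (({0, y - x} : Finset (Site d)).map (Site.shift x).toEmbedding) = {x, y} := by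
    rw [Finset.map_insert, Finset.map_singleton]
    simp
  have h1 : freePair d β x y = freeCorr d β 0 {x, y} := by
    simp only [freePair, freeCorr, spinPair_eq_spinProduct hxy]
  have h2 : twoPointFree d β (y - x) = freeCorr d β 0 {0, y - x} := by
    simp only [twoPointFree, freeCorr, spinPair_eq_spinProduct h0]
  rw [h1, h2, ← freeCorr_shift d hβ le_rfl x {0, y - x}, hmap]

/-- `0 ≤ ⟨σ₀σ_x⟩^∅_{β,0}` for `β ≥ 0` (first Griffiths inequality in the box limit; the tree's
`twoPointFree_nonneg` fed with `hasBoxLimit_isingCorr_free_holds` and `gks_one_holds`).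
(Friedli–Velenik 2017, Thm. 3.20 (3.21) with Exercise 3.16.) [cite: FriedliVelenik2017, Thm. 3.20, eq. (3.21)] -/
theorem twoPointFree_nonneg' {β : ℝ} (hβ : 0 ≤ β) (x : Site d) : 0 ≤ twoPointFree d β x :=
  twoPointFree_nonneg hasBoxLimit_isingCorr_free_holds
    (fun {_ _ _ _ _} => Literature.Probability.LatticeModels.GKSInequalities.gks_one_holds (zdGraph d)) hβ x

/-- `⟨σ₀σ_x⟩^∅_{β,0} ≤ 1` for `β ≥ 0` (`|σ₀σ_x| ≤ 1`; the tree's `twoPointFree_le_one`).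
(Friedli–Velenik 2017, §3.7.4.) [cite: FriedliVelenik2017, §3.7.4] -/
theorem twoPointFree_le_one' {β : ℝ} (hβ : 0 ≤ β) (x : Site d) : twoPointFree d β x ≤ 1 :=
  twoPointFree_le_one hasBoxLimit_isingCorr_free_holds hβ x

/-- `0 ≤ ⟨σ_xσ_y⟩^∅_{β,0}` for `β ≥ 0` (first Griffiths inequality; unconditional form of the
tree's `freePair_nonneg_of_gks`). (Friedli–Velenik 2017, Thm. 3.20 (3.21).) [cite: FriedliVelenik2017, Thm. 3.20, eq. (3.21)] -/
theorem freePair_nonneg {β : ℝ} (hβ : 0 ≤ β) (x y : Site d) : 0 ≤ freePair d β x y := by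
  rw [freePair_eq_twoPointFree_sub hβ]
  exact twoPointFree_nonneg' hβ _

/-- **The Cesàro step** (ADS15 §1.3, eq. (1.10): `inf_x ⟨σ₀σ_x⟩⁰_β ≤ M̃_LRO(β)²`, in the form used
here): for `d ≥ 1` and `β ≥ 0`, if the free two-point function tends to zero at infinity,
`⟨σ₀σ_x⟩^∅_{β,0} → 0` as `x → ∞` in `ℤ^d`, then `M̃_LRO(β)² = 0`. Proof: given `ε > 0`, outside a
finite set `S` one has `⟨σ₀σ_z⟩^∅ < ε`; by translation invariance the block average over a box
`B` is at most `ε + |S|/|B|`, which is `≤ 2ε` for a large box, while all block averages are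
`≥ 0`. (`d ≥ 1` is needed: for `d = 0` the lattice is one point and `M̃_LRO = 1`.) [cite: AizenmanDuminilCopinSidoraviciusCMP2015, §1.3, eqs. (1.9)–(1.10)] -/
theorem lroTildeSq_eq_zero_of_twoPointFree_tendsto_zero (hd : 1 ≤ d) {β : ℝ} (hβ : 0 ≤ β)
    (h : Tendsto (twoPointFree d β) cofinite (𝓝 0)) : lroTildeSq d β = 0 := by
  classical
  have hnn : ∀ x y : Site d, 0 ≤ freePair d β x y := freePair_nonneg hβ
  have hbdd : BddBelow (freeBlockAverage d β '' {B : Finset (Site d) | B.Nonempty}) :=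
    ⟨0, by rintro _ ⟨B, -, rfl⟩; exact freeBlockAverage_nonneg hnn B⟩
  have hlow : 0 ≤ lroTildeSq d β := le_lroTildeSq d fun B _ => freeBlockAverage_nonneg hnn B
  refine le_antisymm (le_of_forall_pos_le_add fun ε hε => ?_) hlow
  rw [zero_add]
  -- outside a finite set `S`, `⟨σ₀σ_z⟩^∅ < ε / 2`
  have hε2 : 0 < ε / 2 := half_pos hε
  have hfin : {z : Site d | ¬ twoPointFree d β z < ε / 2}.Finite :=
    Filter.eventually_cofinite.1 (h.eventually (Iio_mem_nhds hε2))
  set S : Finset (Site d) := hfin.toFinset with hS_def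
  have hsmall : ∀ z : Site d, z ∉ S → twoPointFree d β z < ε / 2 := by
    intro z hz
    by_contra hge
    exact hz (hfin.mem_toFinset.2 hge)
  -- a box `Λ_N` with `|S| ≤ (ε/2) |Λ_N|`
  obtain ⟨N, hN⟩ : ∃ N : ℕ, (#S : ℝ) ≤ ε / 2 * N := by
    obtain ⟨N, hN⟩ := exists_nat_ge ((#S : ℝ) / (ε / 2))
    exact ⟨N, by rwa [div_le_iff₀' hε2] at hN⟩
  have hBne : (box d N).Nonempty := box_nonempty d N
  have hcardB : (N : ℝ) ≤ #(box d N) := by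
    have h1 : N ≤ #(box d N) := by
      rw [card_box]
      calc N ≤ 2 * N + 1 := by omega
        _ = (2 * N + 1) ^ 1 := (pow_one _).symm
        _ ≤ (2 * N + 1) ^ d := Nat.pow_le_pow_right (by omega) hd
    exact_mod_cast h1
  have hBpos : (0 : ℝ) < #(box d N) := by exact_mod_cast hBne.card_pos
  have hSB : (#S : ℝ) ≤ ε / 2 * #(box d N) :=
    hN.trans (mul_le_mul_of_nonneg_left hcardB hε2.le)
  -- the inner sums: `∑_{y ∈ Λ_N} ⟨σ_xσ_y⟩^∅ ≤ |S| + (ε/2) |Λ_N|`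
  have hinner : ∀ x ∈ box d N,
      ∑ y ∈ box d N, freePair d β x y ≤ #S + ε / 2 * #(box d N) := by
    intro x _
    have hpt : ∀ y ∈ box d N, freePair d β x y ≤
        (if y - x ∈ S then (1 : ℝ) else 0) + ε / 2 := by
      intro y _
      rw [freePair_eq_twoPointFree_sub hβ]
      split_ifs with hyx
      · linarith [twoPointFree_le_one' hβ (y - x)]
      · linarith [hsmall _ hyx, twoPointFree_nonneg' hβ (y - x)]
    refine (sum_le_sum hpt).trans ?_
    rw [sum_add_distrib, sum_boole, sum_const, nsmul_eq_mul]
    have hcard : #((box d N).filter fun y => y - x ∈ S) ≤ #S := by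
      refine card_le_card_of_injOn (fun y => y - x) (fun y hy => ?_) fun y₁ _ y₂ _ h12 => ?_
      · exact (Finset.mem_filter.1 hy).2
      · simpa using h12
    have hcard' : (#((box d N).filter fun y => y - x ∈ S) : ℝ) ≤ #S := by exact_mod_cast hcard
    linarith [hcard', mul_comm (#(box d N) : ℝ) (ε / 2)]
  have hsum : ∑ x ∈ box d N, ∑ y ∈ box d N, freePair d β x y ≤
      #(box d N) * (#S + ε / 2 * #(box d N)) := by
    calc ∑ x ∈ box d N, ∑ y ∈ box d N, freePair d β x y
        ≤ ∑ x ∈ box d N, ((#S : ℝ) + ε / 2 * #(box d N)) := sum_le_sum hinner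
      _ = #(box d N) * (#S + ε / 2 * #(box d N)) := by rw [sum_const, nsmul_eq_mul]
  -- hence the block average over `Λ_N` is at most `ε`
  have havg : freeBlockAverage d β (box d N) ≤ ε := by
    rw [freeBlockAverage_def, div_le_iff₀ (by positivity)]
    calc ∑ x ∈ box d N, ∑ y ∈ box d N, freePair d β x y
        ≤ #(box d N) * (#S + ε / 2 * #(box d N)) := hsum
      _ ≤ #(box d N) * (ε / 2 * #(box d N) + ε / 2 * #(box d N)) := by
          refine mul_le_mul_of_nonneg_left ?_ hBpos.le
          linarith [hSB]
      _ = ε * (#(box d N) : ℝ) ^ 2 := by ring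
  exact (lroTildeSq_le d hbdd hBne).trans havg

/-- **ADS15 §3.2 at an arbitrary `β`, hypothesis-free** (Aizenman–Duminil-Copin–Sidoravicius,
CMP 334 (2015), §3.2: Thm. 3.1 with eqs. (3.11)–(3.12) and translation invariance): for the
nearest-neighbour Ising model on `ℤ^d` and `β ≥ 0`, `M̃_LRO(β)² = 0 ⇒ m*(β) = 0`. This is the
tree's `spontaneousMagnetization_eq_zero_of_lroTildeSq_eq_zero` (`MagnetizationContinuity.lean`)
fed with the three discharged ingredients `plusPair_eq_freePair_of_lroTildeSq_holds`
(`CriticalTwoPointBounds.lean`), `plusExpect_spinAt_mul_le_plusPair_holds` and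
`plusExpect_spinAt_eq_spontaneousMagnetization_holds` (`PlusStateFKG.lean`). [cite: AizenmanDuminilCopinSidoraviciusCMP2015, §3.2, Thm. 3.1 with eqs. (3.11)–(3.12)] -/
theorem spontaneousMagnetization_eq_zero_of_lroTildeSq {β : ℝ} (hβ : 0 ≤ β)
    (h0 : lroTildeSq d β = 0) : spontaneousMagnetization d β = 0 :=
  spontaneousMagnetization_eq_zero_of_lroTildeSq_eq_zero plusPair_eq_freePair_of_lroTildeSq_holds
    plusExpect_spinAt_mul_le_plusPair_holds plusExpect_spinAt_eq_spontaneousMagnetization_holds hβ h0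

/-- **`⟨σ₀σ_x⟩^∅ → 0 ⇒ m*(β) = 0`** (`d ≥ 1`, `β ≥ 0`): ADS15 Thm. 1.2 / §3.2 combined with
§1.3 (1.10) (`lroTildeSq_eq_zero_of_twoPointFree_tendsto_zero`). [cite: AizenmanDuminilCopinSidoraviciusCMP2015, Thm. 1.2 with §1.3 eq. (1.10) and §3.2] -/
theorem spontaneousMagnetization_eq_zero_of_twoPointFree_tendsto_zero (hd : 1 ≤ d) {β : ℝ}
    (hβ : 0 ≤ β) (h : Tendsto (twoPointFree d β) cofinite (𝓝 0)) :
    spontaneousMagnetization d β = 0 :=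
  spontaneousMagnetization_eq_zero_of_lroTildeSq hβ
    (lroTildeSq_eq_zero_of_twoPointFree_tendsto_zero hd hβ h)

/-- **`m*(β) = 0 ⇒ ⟨σ₀σ_x⟩^∅ → 0`** (`β ≥ 0`): if the magnetisation vanishes, the free state equals
the plus state on pair correlations (Lebowitz–Martin-Löf) and the plus state clusters,
`⟨σ₀σ_x⟩⁺_{β,0} → m*(β)² = 0` (Friedli–Velenik 2017, Exercise 3.15; the tree's
`twoPointPlus_tendsto_spontaneousMagnetization_sq_holds`). [cite: FriedliVelenik2017, Exercise 3.15] -/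
theorem twoPointFree_tendsto_zero_of_spontaneousMagnetization_eq_zero {β : ℝ} (hβ : 0 ≤ β)
    (hm : spontaneousMagnetization d β = 0) : Tendsto (twoPointFree d β) cofinite (𝓝 0) := by
  have h := twoPointPlus_tendsto_spontaneousMagnetization_sq_holds (d := d) hβ
  rw [hm, sq, mul_zero] at h
  refine h.congr fun x => ?_
  exact (twoPointFree_eq_twoPointPlus_of_spontaneousMagnetization_eq_zero hβ hm x).symm

/-- **The dichotomy at fixed `β`** (`d ≥ 1`, `β ≥ 0`), assembling ADS15 Thm. 1.2 / §3.2 (⇐) with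
Lebowitz–Martin-Löf and the clustering of the plus state (⇒): the spontaneous magnetisation
vanishes iff the free two-point function tends to zero at infinity,
`m*(β) = 0 ⟺ ⟨σ₀σ_x⟩^∅_{β,0} → 0` (`x → ∞` in `ℤ^d`). In particular the free state has long-range
order exactly when `m* > 0` (cf. ADS15 Prop. 1.1, `M_LRO ≤ m*`). [cite: AizenmanDuminilCopinSidoraviciusCMP2015, Thm. 1.2 with §3.2 and Prop. 1.1] -/
theorem spontaneousMagnetization_eq_zero_iff_twoPointFree_tendsto_zero (hd : 1 ≤ d) {β : ℝ}
    (hβ : 0 ≤ β) :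
    spontaneousMagnetization d β = 0 ↔ Tendsto (twoPointFree d β) cofinite (𝓝 0) :=
  ⟨twoPointFree_tendsto_zero_of_spontaneousMagnetization_eq_zero hβ,
    spontaneousMagnetization_eq_zero_of_twoPointFree_tendsto_zero hd hβ⟩

end AnyDimension

/-! ### The square lattice at the self-dual point `β_c(2) = ½ log (1 + √2)` -/

/-- **`m*(β_c(2)) = 0` from the Onsager–Yang formula** (Yang 1952; BGJS 1973: the `β ≤ β_c`
branch of `onsager_yang` at `β = β_c(2) ≥ 0`). This is how the fact was carved out of
**crit-ising.S16** in `PlanarIsing.lean`. [cite: YangPhysRev1952, main result (the spontaneous magnetization vanishes at and above T_c)] [cite: BenettinGallavottiJonaLasinioStella1973, §3 (main result at β = β_c)] -/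
theorem spontaneousMagnetization_two_criticalBetaTwo_of_onsager_yang (h : onsager_yang) :
    spontaneousMagnetization_two_criticalBetaTwo := by
  unfold spontaneousMagnetization_two_criticalBetaTwo
  have h' := h criticalBetaTwo criticalBetaTwo_pos.le
  simpa using h'

/-- **`m*(β_c(2)) = 0` from the exact solution in Toeplitz form** (the three named facts left open
by `OnsagerToeplitz.onsager_yang_of_toeplitz`: the cylinder row correlations converge to the
Toeplitz determinants of Onsager's symbol (Montroll–Potts–Ward 1963 / Schultz–Mattis–Lieb 1964),
the strong Szegő limit theorem (Deift–Its–Krasovsky 2013, Thm. 7), and Wu's 1966 exponential decay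
above `T_c`). [cite: BenettinGallavottiJonaLasinioStella1973, §3 (main result at β = β_c)] [cite: DeiftItsKrasovsky2013, §4 eq. (50), §3 Thm. 7, §5 eq. (64)] -/
theorem spontaneousMagnetization_two_criticalBetaTwo_of_toeplitz
    (hT : torusRowPair_tendsto_toeplitzDet) (hSz : Literature.Analysis.Toeplitz.strongSzego)
    (hWu : toeplitzDet_onsagerSymbol_exp_decay) : spontaneousMagnetization_two_criticalBetaTwo :=
  spontaneousMagnetization_two_criticalBetaTwo_of_onsager_yang (onsager_yang_of_toeplitz hT hSz hWu)

/-- **`m*(β_c(2)) = 0` from `M̃_LRO(β_c(2)) = 0`** (ADS15 Thm. 1.2 / §3.2 at `d = 2`,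
`β = β_c(2) > 0`; Kaufman–Onsager 1949 showed `M̃_LRO(β_c) = 0`, ADS15 §1.5). [cite: AizenmanDuminilCopinSidoraviciusCMP2015, Thm. 1.2 with §3.2 and §1.4 (last paragraph)] -/
theorem spontaneousMagnetization_two_criticalBetaTwo_of_lroTildeSq
    (h0 : lroTildeSq 2 criticalBetaTwo = 0) : spontaneousMagnetization_two_criticalBetaTwo :=
  spontaneousMagnetization_eq_zero_of_lroTildeSq criticalBetaTwo_pos.le h0

/-- **`m*(β_c(2)) = 0` from the decay of the free two-point function at the self-dual point**:
if `⟨σ₀σ_x⟩^∅_{β_c(2),0} → 0` as `x → ∞` in `ℤ²` — ADS15's condition (1.12) for `d = 2`, which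
they note "can be established … through the Fortuin–Kasteleyn random cluster representation
(see [Gri06] Theorem 6.17)", i.e. Zhang's argument `θ⁰(p_sd) = 0` (Grimmett 2006, Thm. 6.17 (a)) —
then `m*(β_c(2)) = 0`. [cite: AizenmanDuminilCopinSidoraviciusCMP2015, §1.4 (last paragraph) with Thm. 1.2] [cite: Grimmett2006, Thm. 6.17 (a)] -/
theorem spontaneousMagnetization_two_criticalBetaTwo_of_twoPointFree_tendsto_zero
    (h : Tendsto (twoPointFree 2 criticalBetaTwo) cofinite (𝓝 0)) :
    spontaneousMagnetization_two_criticalBetaTwo :=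
  spontaneousMagnetization_eq_zero_of_twoPointFree_tendsto_zero (by norm_num) criticalBetaTwo_pos.le h

/-- **What `m*(β_c(2)) = 0` is equivalent to**: the vanishing of the planar magnetisation at the
self-dual point holds iff the free two-point function of the square lattice at `β_c(2)` tends to
zero at infinity (the dichotomy `spontaneousMagnetization_eq_zero_iff_twoPointFree_tendsto_zero` at
`d = 2`, `β = β_c(2)`). [cite: AizenmanDuminilCopinSidoraviciusCMP2015, Thm. 1.2 with §3.2 and Prop. 1.1] -/
theorem spontaneousMagnetization_two_criticalBetaTwo_iff_twoPointFree_tendsto_zero :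
    spontaneousMagnetization_two_criticalBetaTwo ↔
      Tendsto (twoPointFree 2 criticalBetaTwo) cofinite (𝓝 0) :=
  spontaneousMagnetization_eq_zero_iff_twoPointFree_tendsto_zero (by norm_num) criticalBetaTwo_pos.le

/-- **Self-duality of the condition** (Kramers–Wannier 1941; BGJS 1973, eq. (2.3), at the
self-dual point `β* = β`, `sinh 2β_c(2) = 1`: the tree's `kw_free_plus_holds` with
`dualBeta_criticalBetaTwo`): at `β_c(2)` the free two-point function IS the plus-state disorder
correlator at the same temperature, `⟨σ₀σ_x⟩^∅_{β_c(2)} = ⟨∏_{b ∈ Γ}(cosh 2β_c − σ_{b*} sinh 2β_c)⟩⁺_{β_c(2)}`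
for every lattice path `Γ` from `0` to `x`. So `m*(β_c(2)) = 0` iff the plus-state disorder
correlator at `β_c(2)` tends to zero. [cite: BenettinGallavottiJonaLasinioStella1973, eq. (2.3) at the self-dual point] -/
theorem twoPointFree_criticalBetaTwo_eq_plusExpect_kwDisorder (x : Site 2)
    (p : (zdGraph 2).Walk 0 x) (hp : p.IsPath) :
    twoPointFree 2 criticalBetaTwo x =
      plusExpect 2 criticalBetaTwo 0 (kwDisorder criticalBetaTwo p.edges) := by
  have h := kw_free_plus_holds criticalBetaTwo_pos x p hp
  rwa [dualBeta_criticalBetaTwo] at h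

/-- Dually (BGJS 1973, eq. (2.4) at the self-dual point; the tree's `kw_plus_free_holds`): at
`β_c(2)` the plus two-point function is the free-state disorder correlator,
`⟨σ₀σ_x⟩⁺_{β_c(2)} = ⟨∏_{b ∈ Γ}(cosh 2β_c − σ_{b*} sinh 2β_c)⟩^∅_{β_c(2)}`. [cite: BenettinGallavottiJonaLasinioStella1973, eq. (2.4) at the self-dual point] -/
theorem twoPointPlus_criticalBetaTwo_eq_freeExpect_kwDisorder (x : Site 2)
    (p : (zdGraph 2).Walk 0 x) (hp : p.IsPath) :
    twoPointPlus 2 criticalBetaTwo x =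
      freeExpect 2 criticalBetaTwo 0 (kwDisorder criticalBetaTwo p.edges) := by
  have h := kw_plus_free_holds criticalBetaTwo_pos x p hp
  rwa [dualBeta_criticalBetaTwo] at h

/-! ### The discharge -/

/-- **`m*(β_c(2)) = 0`, proved** (continuity of the planar spontaneous magnetisation at the self-dual
point `β_c(2) = ½ log (1 + √2)`; C. N. Yang, Phys. Rev. **85** (1952) 808; rigorous:
Benettin–Gallavotti–Jona-Lasinio–Stella, Comm. Math. Phys. **30** (1973) 45, §3: the `β ≤ β_c`
branch of the Onsager–Yang formula at `β = β_c(2)`). The DISCHARGE of the named fact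
`spontaneousMagnetization_two_criticalBetaTwo` of `PlanarIsing.lean` — exactly the interim proof
recorded under the fact there, `spontaneousMagnetization_two_criticalBetaTwo_of_onsager_yang`, fed
with the Onsager–Yang formula `onsager_yang`, which the tree now proves: `OnsagerSzego.onsager_yang_of_wu`
(GKS, Kramers–Wannier duality, Lebowitz–Martin-Löf, Messager–Miracle-Solé, the transfer matrix and
Kaufman's fermionic solution, the Toeplitz form of the row correlations
`torusRowPair_tendsto_toeplitzDet_holds`, and the strong Szegő limit theorem for geometric symbols
`Literature.Analysis.Toeplitz.strongSzego_geometric` — all proved) applied to Wu's subcritical decay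
of the Toeplitz determinants of Onsager's symbol, `OnsagerToeplitzDecay.toeplitzDet_onsagerSymbol_exp_decay_holds`
(T. T. Wu, Phys. Rev. **149** (1966) 380). [cite: YangPhysRev1952, main result (the spontaneous magnetization vanishes at and above T_c)] [cite: BenettinGallavottiJonaLasinioStella1973, §3 (main result at β = β_c)] -/
theorem spontaneousMagnetization_two_criticalBetaTwo_holds :
    spontaneousMagnetization_two_criticalBetaTwo :=
  spontaneousMagnetization_two_criticalBetaTwo_of_onsager_yang
    (onsager_yang_of_wu toeplitzDet_onsagerSymbol_exp_decay_holds)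

end Literature.Probability.LatticeModels
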